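import Mathlib
import Summits.CriticalPhenomena.CardyFormulaZ2.Theorems.CardyMagicRigidityPositiveConeDefs
import HarnessLib

/-!
# Vocabulary r4 of line `positive-cone-weight-doubling` for crux `NestingRigidity` (stmt-CriticalPhenomena-4835):
# JOINT (multi-family) and TYPED nesting statistics, TAME supports, and the composition glue

Route `CardyMagicRigidity` (sub-problem `CriticalPhenomena/CardyFormulaZ2`), crux
`Summit.CriticalPhenomena.CardyFormulaZ2.Theses.CardyMagicRigidity.NestingRigidity ≡ MagicFormulaZ2 → MagicFormulaT →
LoopLimitZ2EqT`.  Definitions module of the lead reshape r4 of the checked skeleton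
`Cruxes/NestingRigidity/Lines/positive_cone_weight_doubling.lean` (lead seat c4-0, 2026-08-16), companion of
`Theorems/CardyMagicRigidityPositiveConeDefs.lean` (p96037) whose single-family milestones it replaces.  WHY: the
single-family statement `TreeRigidity` of p96037 is insufficient AS A PRINCIPLE in two ways certified in the tree —
(G1) `Regular` does not make a loop a function of its winding interior across configurations
(`exists_regular_patternCount_eq_not_isClose`, p120899), and (G2) family-by-family agreement of the count laws does not
determine their JOINT law (`exists_regular_laws_familywise_eq_jointly_ne`, p129546: needled `Regular` loops hidden by cut
discs) — and it lacks the measurability needed at law level (G3).  This module carries, sorry-free: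

* §1 VOCABULARY: `Tame` loops (single-signed degree one, trace = frontier of the interior, SOLID, at most DOUBLE
  points — the support class on which the winding function is to determine the loop), `typedPatternCount`, the JOINT
  tilted moments / cylinder probabilities of finitely many disc families (`jointTilt`, `jointCyl`) and the milestones
  `JointTiltAgreementAt`, `JointLawAgreementAt`, `JointPositiveTiltAgreement`, `JointNestingLawAgreement`,
  `TypedJointNestingLawAgreement`, `TamePrecompact E` (tame regular subsequential `d_CN`-limits with MEASURABLE typed
  counts and closeness events), `TreeRigidityTame` (tree rigidity on tame supports with typed joint statistics);
* §2 the pure-logic GLUE `nestingRigidity_of_statements_r4`: `ConeScaling → WeightDoubling → (joint tomography) →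
  (joint PGF uniqueness) → (JointNestingLawAgreement → TypedJointNestingLawAgreement) → TamePrecompact zEns ∧
  TamePrecompact tEns → TreeRigidityTame → NestingRigidity` — the anchor of this module on the crux item.

Nothing here is asserted: every `def … : Prop` is a statement to be proved by a registered stub (audit
`TreeRigidity-audit.md` of seat c4-0: what each consumer already has landed — p128704, p129918, p130005 for
`TreeRigidityTame`; p128809, p128987, p129158, p129294, p129600, p129759, p129890 for `TamePrecompact`).
-/

noncomputable section

open MeasureTheory Filter Set Topology
open scoped Real ENNReal BigOperators
open Literature.Probability.RandomPlanarGeometry Literature.Probability.Percolation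
  Literature.Probability.LatticeModels
open Summit.CriticalPhenomena.CardyFormulaZ2.Theses.CardyMagicRigidity
open Summit.CriticalPhenomena.CardyFormulaZ2.Cruxes.NestingRigidity.RingCloudTomography

namespace Summit.CriticalPhenomena.CardyFormulaZ2.Cruxes.NestingRigidity.PositiveConeWeightDoubling

/-! ## §1 Vocabulary of the reshaped identification / Transfer complex (r4) -/

/-- **TAME loops** (audit §2): single-signed degree one, trace = frontier of the winding interior, SOLID
(no inward needle) and at most DOUBLE points — the support class on which `W(u,·)` is to determine `u`
(`tame_rigidity`, registered helper); every clause is expected a.s. for both lattice limits (udist-stability of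
`W`; polychromatic 4-arm dimension `< 1`; 6-arm exponent `> 2`). -/
structure Tame (u : UnbasedLoop ℂ) : Prop where
  /-- `W ∈ {0, 1}` everywhere, or `W ∈ {0, −1}` everywhere -/
  signedDegreeOne : (∀ z, u.wind z = 0 ∨ u.wind z = 1) ∨ (∀ z, u.wind z = 0 ∨ u.wind z = -1)
  /-- the trace is the frontier of the winding interior -/
  boundary : u.range = frontier {z | u.wind z ≠ 0}
  /-- no inward needles: the interior is the interior of its closure -/
  solid : interior ({z | u.wind z ≠ 0} ∪ u.range) = {z | u.wind z ≠ 0}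
  /-- some parametrisation visits no point three times -/
  atMostDouble : ∃ (γ : Curve ℂ) (hγ : γ.IsLoop),
    UnbasedLoop.mk (BasedLoop.mk (CurveClass.mk γ) hγ) = u ∧
      ∀ t₁ t₂ t₃ : unitInterval, t₁ < 1 → t₂ < 1 → t₃ < 1 → γ t₁ = γ t₂ → γ t₂ = γ t₃ →
        t₁ = t₂ ∨ t₂ = t₃ ∨ t₁ = t₃

/-- Typed pattern count: loops OF TYPE `i` in the window surrounding exactly the discs of `S` (shape of p130005). -/
def typedPatternCount (c : LoopConfig ℂ) (i : Fin 2) {n : ℕ} (z : Fin n → ℂ) (r : Fin n → ℝ) (R : ℝ)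
    (S : Finset (Fin n)) : ℕ :=
  patternCount (⟨fun j ↦ if j = i then c.F i else ∅⟩ : LoopConfig ℂ) z r R S

/-- Joint tilted moment of `J` disc families (common `n`; far/degenerate discs are inert). -/
def jointTilt (E : LoopEnsemble) {J n : ℕ} (x : Fin J → Fin n → ℂ) (r : Fin J → Fin n → ℝ) (R : Fin J → ℝ)
    (u : Fin J → Finset (Fin n) → ℝ) (δ : ℝ) : ℝ :=
  ∫ ω, ∏ j, ∏ S ∈ nonemptyParts n, u j S ^ patternCount (E.X δ ω) (x j) (r j) (R j) S ∂E.P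

/-- Joint cylinder probability of the count vectors of `J` disc families. -/
def jointCyl (E : LoopEnsemble) {J n : ℕ} (x : Fin J → Fin n → ℂ) (r : Fin J → Fin n → ℝ) (R : Fin J → ℝ)
    (k : Fin J → Finset (Fin n) → ℕ) (δ : ℝ) : ℝ :=
  (E.P {ω | ∀ j, ∀ S : Finset (Fin n), S.Nonempty → patternCount (E.X δ ω) (x j) (r j) (R j) S = k j S}).toReal

/-- Joint tilted-moment agreement at `J` disc families (open weight set, eventual bounds, asymptotic equality). -/
def JointTiltAgreementAt (J n : ℕ) (x : Fin J → Fin n → ℂ) (r : Fin J → Fin n → ℝ) (R : Fin J → ℝ) : Prop :=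
  ∃ U : Set (Fin J → Finset (Fin n) → ℝ), IsOpen U ∧ U.Nonempty ∧ (∀ u ∈ U, ∀ j S, 0 < u j S) ∧
    ∀ u ∈ U, (∃ M : ℝ, ∀ᶠ δ in 𝓝[>] (0 : ℝ), jointTilt zEns x r R u δ ≤ M ∧ jointTilt tEns x r R u δ ≤ M) ∧
      Tendsto (fun δ : ℝ ↦ jointTilt zEns x r R u δ - jointTilt tEns x r R u δ) (𝓝[>] 0) (𝓝 0)

/-- Joint law agreement at `J` disc families. -/
def JointLawAgreementAt (J n : ℕ) (x : Fin J → Fin n → ℂ) (r : Fin J → Fin n → ℝ) (R : Fin J → ℝ) : Prop :=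
  ∀ k : Fin J → Finset (Fin n) → ℕ,
    Tendsto (fun δ : ℝ ↦ jointCyl zEns x r R k δ - jointCyl tEns x r R k δ) (𝓝[>] 0) (𝓝 0)

/-- **Joint positive tilt agreement** (output of `stub_ringTomographyJoint`): a.e. radii/windows, every `J`. -/
def JointPositiveTiltAgreement : Prop :=
  ∀ (J n : ℕ) (x : Fin J → Fin n → ℂ), ∀ᵐ p : (Fin J → Fin n → ℝ) × (Fin J → ℝ),
    (∀ j i, 0 < p.1 j i) → (∀ j, 0 < p.2 j) → JointTiltAgreementAt J n x p.1 p.2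

/-- **Joint nesting-law agreement** (untyped): a.e. radii/windows, every `J`. -/
def JointNestingLawAgreement : Prop :=
  ∀ (J n : ℕ) (x : Fin J → Fin n → ℂ), ∀ᵐ p : (Fin J → Fin n → ℝ) × (Fin J → ℝ),
    (∀ j i, 0 < p.1 j i) → (∀ j, 0 < p.2 j) → JointLawAgreementAt J n x p.1 p.2

/-- **Typed joint nesting-law agreement** (audit §6 verbatim): cylinder laws of the TYPED count vectors of finitely
many disc families agree asymptotically, a.e. radii/windows. -/
def TypedJointNestingLawAgreement : Prop :=
  ∀ (J n : ℕ) (x : Fin J → Fin n → ℂ), ∀ᵐ p : (Fin J → Fin n → ℝ) × (Fin J → ℝ),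
    (∀ j i, 0 < p.1 j i) → (∀ j, 0 < p.2 j) → ∀ k : Fin J → Fin 2 → Finset (Fin n) → ℕ,
      Tendsto (fun δ : ℝ ↦
        (zEns.P {ω | ∀ j t, ∀ S : Finset (Fin n), S.Nonempty →
            typedPatternCount (zEns.X δ ω) t (x j) (p.1 j) (p.2 j) S = k j t S}).toReal -
        (tEns.P {ω | ∀ j t, ∀ S : Finset (Fin n), S.Nonempty →
            typedPatternCount (tEns.X δ ω) t (x j) (p.1 j) (p.2 j) S = k j t S}).toReal) (𝓝[>] 0) (𝓝 0)

/-- **Tame precompactness** of an ensemble: subsequential `d_CN`-limits presented on `([0,1], Leb)` with a.e.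
TAME REGULAR values, MEASURABLE typed counts and MEASURABLE closeness events against both lattice ensembles. -/
def TamePrecompact (E : LoopEnsemble) : Prop :=
  ∀ δs : ℕ → ℝ, Tendsto δs atTop (𝓝[>] (0 : ℝ)) →
    ∃ φ : ℕ → ℕ, StrictMono φ ∧ ∃ X : unitInterval → LoopConfig ℂ,
      (∀ᵐ s : unitInterval, Regular (X s) ∧ ∀ u ∈ (X s).loops, Tame u) ∧
      (∀ (i : Fin 2) (n : ℕ) (x : Fin n → ℂ) (r : Fin n → ℝ) (R : ℝ) (S : Finset (Fin n)),
        Measurable fun s ↦ typedPatternCount (X s) i x r R S) ∧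
      (∀ (ε δ : ℝ), ∀ E' ∈ latticeEnsembles,
        MeasurableSet {p : E'.Ω × unitInterval | LoopConfig.IsClose ε (E'.X δ p.1) (X p.2)}) ∧
      Tendsto (fun k : ℕ ↦ LoopConfig.cnLawEDist E.P (E.X (δs (φ k))) volume X) atTop (𝓝 0)

/-- **Tree rigidity on tame supports, typed joint statistics** (audit §6 without the `tame_rigidity`
hypothesis, which its prover supplies through the registered helper `tame_rigidity`). -/
def TreeRigidityTame : Prop :=
  ∀ (δs : ℕ → ℝ) (X X' : unitInterval → LoopConfig ℂ), Tendsto δs atTop (𝓝[>] (0 : ℝ)) →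
    Tendsto (fun k : ℕ ↦ LoopConfig.cnLawEDist zEns.P (zEns.X (δs k)) volume X) atTop (𝓝 0) →
    Tendsto (fun k : ℕ ↦ LoopConfig.cnLawEDist tEns.P (tEns.X (δs k)) volume X') atTop (𝓝 0) →
    (∀ᵐ s : unitInterval, Regular (X s) ∧ ∀ u ∈ (X s).loops, Tame u) →
    (∀ᵐ s : unitInterval, Regular (X' s) ∧ ∀ u ∈ (X' s).loops, Tame u) →
    (∀ (i : Fin 2) (n : ℕ) (x : Fin n → ℂ) (r : Fin n → ℝ) (R : ℝ) (S : Finset (Fin n)),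
      Measurable (fun s ↦ typedPatternCount (X s) i x r R S) ∧
      Measurable (fun s ↦ typedPatternCount (X' s) i x r R S)) →
    (∀ (ε : ℝ) (k : ℕ), MeasurableSet {p : tEns.Ω × unitInterval |
      LoopConfig.IsClose ε (tEns.X (δs k) p.1) (X p.2)}) →
    TypedJointNestingLawAgreement →
      Tendsto (fun k : ℕ ↦ LoopConfig.cnLawEDist zEns.P (zEns.X (δs k)) tEns.P (tEns.X (δs k))) atTop (𝓝 0)

/-! ## §2 The composition glue r4 (pure logic): the seven statements imply the crux, by name -/

/-- **Glue r4** (pure logic): the n = 1 lever (`ConeScaling`, `WeightDoubling`), joint tomography, joint PGF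
uniqueness, lattice types, tame precompactness of both ensembles and tame tree rigidity imply `NestingRigidity`:
calibrate from `MagicFormulaZ2`; get joint tilt agreement (+ `MagicFormulaT`); peel to joint laws a.e.
(`Eventually.mono`); type them on the lattice; along every mesh sequence extract sub-subsequences on which bond-`ℤ²`
and then site-`𝕋` converge to tame regular measurable presentations; conclude along them
(`Filter.tendsto_of_subseq_tendsto`). -/
theorem nestingRigidity_of_statements_r4 :
    ConeScaling → WeightDoubling →
      (MagicFormulaZ2 → MagicFormulaT → ConeTiltLaw zEns → NestingDensity zEns → JointPositiveTiltAgreement) →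
      (∀ (J n : ℕ) (x : Fin J → Fin n → ℂ) (r : Fin J → Fin n → ℝ) (R : Fin J → ℝ), JointTiltAgreementAt J n x r R → JointLawAgreementAt J n x r R) →
      (JointNestingLawAgreement → TypedJointNestingLawAgreement) →
      TamePrecompact zEns ∧ TamePrecompact tEns → TreeRigidityTame → NestingRigidity := by
  intro h₁ h₂ h₃ h₄ h₅ h₆ h₇ hZ hT
  have hcone : ConeTiltLaw zEns := h₁ hZ
  have hdens : NestingDensity zEns := h₂ hZ hcone
  have htilt : JointPositiveTiltAgreement := h₃ hZ hT hcone hdens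
  have hlaw : JointNestingLawAgreement := fun J n x ↦
    (htilt J n x).mono fun p hp hr hR ↦ h₄ J n x p.1 p.2 (hp hr hR)
  have htyped : TypedJointNestingLawAgreement := h₅ hlaw
  obtain ⟨hpZ, hpT⟩ := h₆
  change Tendsto (fun δ : ℝ ↦ LoopConfig.cnLawEDist zEns.P (zEns.X δ) tEns.P (tEns.X δ)) (𝓝[>] 0) (𝓝 0)
  refine Filter.tendsto_of_subseq_tendsto fun δs hδs ↦ ?_
  obtain ⟨φ, hφ, X, hXreg, hXmeas, hXclose, hXlim⟩ := hpZ δs hδs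
  have hδs' : Tendsto (δs ∘ φ) atTop (𝓝[>] (0 : ℝ)) := hδs.comp hφ.tendsto_atTop
  obtain ⟨ψ, hψ, X', hX'reg, hX'meas, -, hX'lim⟩ := hpT (δs ∘ φ) hδs'
  have hδs'' : Tendsto (δs ∘ φ ∘ ψ) atTop (𝓝[>] (0 : ℝ)) := hδs'.comp hψ.tendsto_atTop
  have hXlim' : Tendsto (fun k : ℕ ↦ LoopConfig.cnLawEDist zEns.P (zEns.X ((δs ∘ φ ∘ ψ) k)) volume X)
      atTop (𝓝 0) := hXlim.comp hψ.tendsto_atTop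
  exact ⟨φ ∘ ψ, h₇ (δs ∘ φ ∘ ψ) X X' hδs'' hXlim' hX'lim hXreg hX'reg
    (fun i n x r R S ↦ ⟨hXmeas i n x r R S, hX'meas i n x r R S⟩)
    (fun ε k ↦ hXclose ε ((δs ∘ φ ∘ ψ) k) tEns tEns_mem) htyped⟩


end Summit.CriticalPhenomena.CardyFormulaZ2.Cruxes.NestingRigidity.PositiveConeWeightDoubling

end
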